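import Mathlib
import Summits.Ventures.PercRepro2.Defs
import Summits.Ventures.PercRepro2.HubBernstein
import Summits.Ventures.PercRepro2.PMK5Deg3Kernel
import Summits.Ventures.PercRepro2.Deg3Kron
import Summits.Ventures.PercRepro2.PMK5Deg5Kernel
import Summits.Ventures.PercRepro2.PMK5Deg5Kernel6

/-!
# Kronecker substitution on nine edges in the base `2^28`: the slice numbers of `PMK5Deg5Kernel6.lean` are degree-3 Bernstein coefficients
(blind cell PercRepro2, mine-2 g29; mine-2 g26's `Deg2Kron.lean` (typer-1's `K5Kron.lean`) one edge DOWN — the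
nine free edges of `K₆` once the six edges `9, …, 14` are fixed; the bridge file of the
slice certificates)

* `idx4 k = Σ_e k_e 4^e` for a profile `k : Fin 9 → Fin 4`; `idx4_prof`: the index of a profile of three
  configurations is the sum of their indices (`Deg3.idx`, no carries); `decode4` inverts it below `4^9`.
* `kron_eq_kronSum`: the edge-tree recursion of `PMK5Deg3Kernel.lean` computes the finite sum
  `kronSum T = Σ_ω [T ω] · KB^{idx ω}` (the invariant `go_eq`: `go T n ω` sums over the states of the edges
  `< n`, the others fixed by `ω`).
* `cnt3 T₁ T₂ T₃ k` = the number of configuration triples of profile `k` in `T₁ × T₂ × T₃`, and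
  **`kronSum_mul_mul`**: `kronSum T₁ · kronSum T₂ · kronSum T₃ = Σ_k cnt3 T₁ T₂ T₃ k · KB^{idx4 k}` — a
  product of three encodings is the encoding of the triple counts (the profile convolution; the indices
  add without carries).  `cnt3_le`: `cnt3 ≤ 3^9` (the fibre of a profile has `∏_e C(3, k_e) ≤ 3^9`
  triples), so the slice digits — at most `90` counts — are Kronecker digits (`90 · 3^9 = 15,943,230 < KB = 2^24`).
-/

namespace Summit.Ventures.PercRepro2

open Hub

namespace Deg5

namespace Six

/-! ## Indices of profiles -/

section Index

/-- The base-4 index of a profile. -/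
def idx4 (k : Fin 9 → Fin 4) : ℕ := ∑ i, (k i : ℕ) * 4 ^ (i : ℕ)

/-- The index of a profile is the sum of the indices of the three configurations (no carries). -/
lemma idx4_prof (w₁ w₂ w₃ : Fin 9 → Bool) :
    idx4 (prof w₁ w₂ w₃) = idx w₁ + idx w₂ + idx w₃ := by
  simp only [idx4, idx, prof_apply, add_mul, Finset.sum_add_distrib]

/-- Decoding a base-4 number into a profile. -/
def decode4 (n : ℕ) : Fin 9 → Fin 4 := fun i => ⟨n / 4 ^ (i : ℕ) % 4, Nat.mod_lt _ (by norm_num)⟩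

/-- The index, written out. -/
lemma idx4_eq (k : Fin 9 → Fin 4) : idx4 k =
    k 0 + 4 * k 1 + 16 * k 2 + 64 * k 3 + 256 * k 4 + 1024 * k 5 + 4096 * k 6 + 16384 * k 7 +
      65536 * k 8 := by
  simp only [idx4, Finset.sum_fin_eq_sum_range, Finset.sum_range_succ, Finset.sum_range_zero]
  simp
  ring

set_option maxRecDepth 10000 in
/-- Decoding inverts the index. -/
lemma decode4_idx4 (k : Fin 9 → Fin 4) : decode4 (idx4 k) = k := by
  have h0 := (k 0).isLt
  have h1 := (k 1).isLt
  have h2 := (k 2).isLt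
  have h3 := (k 3).isLt
  have h4 := (k 4).isLt
  have h5 := (k 5).isLt
  have h6 := (k 6).isLt
  have h7 := (k 7).isLt
  have h8 := (k 8).isLt
  have e := idx4_eq k
  funext i
  apply Fin.ext
  fin_cases i
  · show idx4 k / 1 % 4 = (k 0 : ℕ); omega
  · show idx4 k / 4 % 4 = (k 1 : ℕ); omega
  · show idx4 k / 16 % 4 = (k 2 : ℕ); omega
  · show idx4 k / 64 % 4 = (k 3 : ℕ); omega
  · show idx4 k / 256 % 4 = (k 4 : ℕ); omega
  · show idx4 k / 1024 % 4 = (k 5 : ℕ); omega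
  · show idx4 k / 4096 % 4 = (k 6 : ℕ); omega
  · show idx4 k / 16384 % 4 = (k 7 : ℕ); omega
  · show idx4 k / 65536 % 4 = (k 8 : ℕ); omega

/-- The index of a profile is below `4^9`. -/
lemma idx4_lt (k : Fin 9 → Fin 4) : idx4 k < 262144 := by
  have h0 := (k 0).isLt
  have h1 := (k 1).isLt
  have h2 := (k 2).isLt
  have h3 := (k 3).isLt
  have h4 := (k 4).isLt
  have h5 := (k 5).isLt
  have h6 := (k 6).isLt
  have h7 := (k 7).isLt
  have h8 := (k 8).isLt
  rw [idx4_eq]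
  omega

set_option maxRecDepth 10000 in
/-- The index of a decoded number below `4^9` is the number. -/
lemma idx4_decode4 {n : ℕ} (hn : n < 262144) : idx4 (decode4 n) = n := by
  rw [idx4_eq]
  show n / 1 % 4 + 4 * (n / 4 % 4) + 16 * (n / 16 % 4) + 64 * (n / 64 % 4) + 256 * (n / 256 % 4) +
    1024 * (n / 1024 % 4) + 4096 * (n / 4096 % 4) + 16384 * (n / 16384 % 4) +
    65536 * (n / 65536 % 4) = n
  omega

/-- The index is injective. -/
lemma idx4_injective : Function.Injective idx4 := fun k k' h => by
  rw [← decode4_idx4 k, ← decode4_idx4 k', h]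

end Index

/-! ## The edge-tree recursion is the finite sum -/

section Tree

/-- The partial index: the states of the edges `< n`. -/
def idxLt (n : ℕ) (ω : Fin 9 → Bool) : ℕ :=
  ∑ e ∈ Finset.univ.filter (fun e : Fin 9 => (e : ℕ) < n), (ω e).toNat * 4 ^ (e : ℕ)

/-- Two configurations agreeing on the edges `≥ n`. -/
def AgreeGe (n : ℕ) (ω s : Fin 9 → Bool) : Prop := ∀ e : Fin 9, n ≤ (e : ℕ) → s e = ω e

/-- Agreement on the edges `≥ n` is decidable (a finite conjunction). -/
instance (n : ℕ) (ω s : Fin 9 → Bool) : Decidable (AgreeGe n ω s) := by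
  unfold AgreeGe; infer_instance

/-- The edge `n < 9` as an element of `Fin 9`. -/
lemma ofNat_val {n : ℕ} (hn : n < 9) : ((Fin.ofNat 9 n : Fin 9) : ℕ) = n := by
  simp [Fin.ofNat, Nat.mod_eq_of_lt hn]

/-- `idxLt (n+1)` splits off the edge `n`. -/
lemma idxLt_succ {n : ℕ} (hn : n < 9) (s : Fin 9 → Bool) :
    idxLt (n + 1) s = idxLt n s + (s (Fin.ofNat 9 n)).toNat * 4 ^ n := by
  unfold idxLt
  have hset : (Finset.univ.filter fun e : Fin 9 => (e : ℕ) < n + 1) =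
      insert (Fin.ofNat 9 n) (Finset.univ.filter fun e : Fin 9 => (e : ℕ) < n) := by
    ext e
    simp only [Finset.mem_filter, Finset.mem_univ, true_and, Finset.mem_insert]
    constructor
    · intro h
      rcases Nat.lt_succ_iff_lt_or_eq.1 h with h | h
      · exact Or.inr h
      · left; apply Fin.ext; rw [ofNat_val hn, h]
    · rintro (h | h)
      · rw [h, ofNat_val hn]; omega
      · omega
  rw [hset, Finset.sum_insert (by
    simp only [Finset.mem_filter, Finset.mem_univ, true_and, not_lt, ofNat_val hn, le_refl]),
    ofNat_val hn, add_comm]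

/-- The invariant of the tree recursion: `go T n ω` sums over the configurations agreeing with `ω`
on the edges `≥ n`, weighted by the partial index. -/
theorem go_eq (T : (Fin 9 → Bool) → Bool) :
    ∀ (n : ℕ), n ≤ 9 → ∀ ω : Fin 9 → Bool,
      go T n ω = ∑ s ∈ Finset.univ.filter (fun s => AgreeGe n ω s), (T s).toNat * KB ^ idxLt n s
  | 0, _, ω => by
    have hfil : (Finset.univ.filter fun s : Fin 9 → Bool => AgreeGe 0 ω s) = {ω} := by
      ext s
      simp only [Finset.mem_filter, Finset.mem_univ, true_and, Finset.mem_singleton, AgreeGe,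
        Nat.zero_le, true_implies]
      exact ⟨fun h => funext h, fun h e => by rw [h]⟩
    rw [hfil, Finset.sum_singleton]
    simp [go, idxLt]
  | n + 1, hn, ω => by
    have hn' : n < 9 := by omega
    rw [go, go_eq T n (by omega), go_eq T n (by omega)]
    -- split the target sum by the state of edge `n`
    rw [← Finset.sum_filter_add_sum_filter_not (Finset.univ.filter fun s => AgreeGe (n + 1) ω s)
      (fun s : Fin 9 → Bool => s (Fin.ofNat 9 n) = true)]
    rw [Finset.filter_filter, Finset.filter_filter]
    have e0 : (Finset.univ.filter fun s : Fin 9 → Bool => AgreeGe (n + 1) ω s ∧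
        ¬ s (Fin.ofNat 9 n) = true) =
        Finset.univ.filter fun s => AgreeGe n (Function.update ω (Fin.ofNat 9 n) false) s := by
      ext s
      simp only [Finset.mem_filter, Finset.mem_univ, true_and, AgreeGe, Bool.not_eq_true]
      constructor
      · rintro ⟨h, hs⟩ e he
        by_cases hen : e = Fin.ofNat 9 n
        · rw [hen, Function.update_self, hs]
        · rw [Function.update_of_ne hen]
          refine h e ?_
          have : (e : ℕ) ≠ n := fun h' => hen (Fin.ext (by rw [ofNat_val hn', h']))
          omega
      · intro h
        refine ⟨fun e he => ?_, ?_⟩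
        · have hen : e ≠ Fin.ofNat 9 n := fun h' => by
            rw [h', ofNat_val hn'] at he; omega
          rw [← Function.update_of_ne hen false ω]
          exact h e (by omega)
        · have := h (Fin.ofNat 9 n) (by rw [ofNat_val hn'])
          rwa [Function.update_self] at this
    have e1 : (Finset.univ.filter fun s : Fin 9 → Bool => AgreeGe (n + 1) ω s ∧
        s (Fin.ofNat 9 n) = true) =
        Finset.univ.filter fun s => AgreeGe n (Function.update ω (Fin.ofNat 9 n) true) s := by
      ext s
      simp only [Finset.mem_filter, Finset.mem_univ, true_and, AgreeGe]
      constructor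
      · rintro ⟨h, hs⟩ e he
        by_cases hen : e = Fin.ofNat 9 n
        · rw [hen, Function.update_self, hs]
        · rw [Function.update_of_ne hen]
          refine h e ?_
          have : (e : ℕ) ≠ n := fun h' => hen (Fin.ext (by rw [ofNat_val hn', h']))
          omega
      · intro h
        refine ⟨fun e he => ?_, ?_⟩
        · have hen : e ≠ Fin.ofNat 9 n := fun h' => by
            rw [h', ofNat_val hn'] at he; omega
          rw [← Function.update_of_ne hen true ω]
          exact h e (by omega)
        · have := h (Fin.ofNat 9 n) (by rw [ofNat_val hn'])
          rwa [Function.update_self] at this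
    rw [e0, e1, Finset.mul_sum, add_comm]
    congr 1
    · refine Finset.sum_congr rfl fun s hs => ?_
      rw [Finset.mem_filter] at hs
      have hsn : s (Fin.ofNat 9 n) = true := by
        have := hs.2 (Fin.ofNat 9 n) (by rw [ofNat_val hn'])
        rwa [Function.update_self] at this
      rw [idxLt_succ hn', hsn, pow_add]
      simp only [Bool.toNat_true, one_mul]
      ring
    · refine Finset.sum_congr rfl fun s hs => ?_
      rw [Finset.mem_filter] at hs
      have hsn : s (Fin.ofNat 9 n) = false := by
        have := hs.2 (Fin.ofNat 9 n) (by rw [ofNat_val hn'])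
        rwa [Function.update_self] at this
      rw [idxLt_succ hn', hsn]
      simp

/-- The partial index over all nine edges is the index. -/
lemma idxLt_nine (s : Fin 9 → Bool) : idxLt 9 s = idx s := by
  unfold idxLt idx
  apply Finset.sum_congr
  · ext e
    simp only [Finset.mem_filter, Finset.mem_univ, true_and, iff_true]
    exact e.isLt
  · intros; rfl

/-- **The tree recursion is the Kronecker sum**: `kron T = kronSum T`. -/
theorem kron_eq_kronSum (T : (Fin 9 → Bool) → Bool) : kron T = kronSum T := by
  unfold kron kronSum
  rw [go_eq T 9 le_rfl]
  have hfil : (Finset.univ.filter fun s : Fin 9 → Bool => AgreeGe 9 (fun _ => false) s) =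
      Finset.univ := by
    ext s
    simp only [Finset.mem_filter, Finset.mem_univ, true_and, iff_true, AgreeGe]
    intro e he
    exact absurd he (by omega)
  rw [hfil]
  refine Finset.sum_congr rfl fun s _ => ?_
  rw [idxLt_nine]

end Tree

/-! ## Products of three encodings are triple counts -/

section Kron

/-- The number of configuration triples of profile `k` with `T₁ ω₁`, `T₂ ω₂`, `T₃ ω₃`. -/
def cnt3 (T₁ T₂ T₃ : (Fin 9 → Bool) → Bool) (k : Fin 9 → Fin 4) : ℕ :=
  ∑ t : (Fin 9 → Bool) × (Fin 9 → Bool) × (Fin 9 → Bool) with prof t.1 t.2.1 t.2.2 = k,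
    (T₁ t.1).toNat * (T₂ t.2.1).toNat * (T₃ t.2.2).toNat

set_option maxRecDepth 10000 in
set_option linter.constructorNameAsVariable false in
/-- A product of three encodings as a triple sum. -/
lemma kronSum_mul_mul_eq_sum (T₁ T₂ T₃ : (Fin 9 → Bool) → Bool) :
    kronSum T₁ * kronSum T₂ * kronSum T₃ =
      ∑ t : (Fin 9 → Bool) × (Fin 9 → Bool) × (Fin 9 → Bool),
        (T₁ t.1).toNat * (T₂ t.2.1).toNat * (T₃ t.2.2).toNat * KB ^ idx4 (prof t.1 t.2.1 t.2.2) := by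
  unfold kronSum
  rw [Deg3.sum_mul_sum_mul_sum_nat]
  simp only [Fintype.sum_prod_type]
  refine Finset.sum_congr rfl fun a _ => Finset.sum_congr rfl fun b _ =>
    Finset.sum_congr rfl fun c _ => ?_
  rw [idx4_prof, pow_add, pow_add]
  ring

set_option maxRecDepth 10000 in
set_option linter.constructorNameAsVariable false in
/-- **Kronecker substitution on nine edges**: a product of three encodings is the encoding of the triple
counts. -/
theorem kronSum_mul_mul (T₁ T₂ T₃ : (Fin 9 → Bool) → Bool) :
    kronSum T₁ * kronSum T₂ * kronSum T₃ = ∑ k, cnt3 T₁ T₂ T₃ k * KB ^ idx4 k := by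
  rw [kronSum_mul_mul_eq_sum]
  unfold cnt3
  simp only [Finset.sum_mul]
  rw [← Finset.sum_fiberwise Finset.univ
    (fun t : (Fin 9 → Bool) × (Fin 9 → Bool) × (Fin 9 → Bool) => prof t.1 t.2.1 t.2.2)]
  refine Finset.sum_congr rfl fun k _ => Finset.sum_congr rfl fun t ht => ?_
  rw [Finset.mem_filter] at ht
  rw [ht.2]

/-- The fibre of a profile: triples with that profile. -/
def fibre (k : Fin 9 → Fin 4) : Finset ((Fin 9 → Bool) × (Fin 9 → Bool) × (Fin 9 → Bool)) :=
  Finset.univ.filter fun t => prof t.1 t.2.1 t.2.2 = k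

set_option maxRecDepth 10000 in
set_option linter.constructorNameAsVariable false in
/-- A triple count is at most the size of the fibre. -/
lemma cnt3_le_card (T₁ T₂ T₃ : (Fin 9 → Bool) → Bool) (k : Fin 9 → Fin 4) :
    cnt3 T₁ T₂ T₃ k ≤ (fibre k).card := by
  unfold cnt3 fibre
  calc ∑ t ∈ Finset.univ.filter (fun t : (Fin 9 → Bool) × (Fin 9 → Bool) × (Fin 9 → Bool) =>
        prof t.1 t.2.1 t.2.2 = k), (T₁ t.1).toNat * (T₂ t.2.1).toNat * (T₃ t.2.2).toNat
      ≤ ∑ _t ∈ Finset.univ.filter (fun t : (Fin 9 → Bool) × (Fin 9 → Bool) × (Fin 9 → Bool) =>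
        prof t.1 t.2.1 t.2.2 = k), 1 := by
        refine Finset.sum_le_sum fun t _ => ?_
        have h1 := Bool.toNat_le (T₁ t.1)
        have h2 := Bool.toNat_le (T₂ t.2.1)
        have h3 := Bool.toNat_le (T₃ t.2.2)
        calc (T₁ t.1).toNat * (T₂ t.2.1).toNat * (T₃ t.2.2).toNat ≤ 1 * 1 * 1 :=
              Nat.mul_le_mul (Nat.mul_le_mul h1 h2) h3
          _ = 1 := by norm_num
    _ = _ := by simp

set_option maxRecDepth 10000 in
set_option linter.constructorNameAsVariable false in
/-- The fibre of a profile as a product over the edges. -/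
lemma card_fibre_le (k : Fin 9 → Fin 4) : (fibre k).card ≤ 3 ^ 9 := by
  -- re-index triples of configurations as configurations of triples
  let φ : ((Fin 9 → Bool) × (Fin 9 → Bool) × (Fin 9 → Bool)) → (Fin 9 → Bool × Bool × Bool) :=
    fun t e => (t.1 e, t.2.1 e, t.2.2 e)
  have hφ : Function.Injective φ := by
    intro t t' h
    have h1 : t.1 = t'.1 := funext fun e => congrArg (fun x => x.1) (congrFun h e)
    have h2 : t.2.1 = t'.2.1 := funext fun e => congrArg (fun x => x.2.1) (congrFun h e)
    have h3 : t.2.2 = t'.2.2 := funext fun e => congrArg (fun x => x.2.2) (congrFun h e)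
    exact Prod.ext h1 (Prod.ext h2 h3)
  have himage : (fibre k).image φ ⊆ Fintype.piFinset fun e : Fin 9 =>
      Finset.univ.filter fun b : Bool × Bool × Bool =>
        b.1.toNat + b.2.1.toNat + b.2.2.toNat = (k e : ℕ) := by
    intro F hF
    rw [Finset.mem_image] at hF
    obtain ⟨t, ht, rfl⟩ := hF
    rw [Fintype.mem_piFinset]
    intro e
    rw [Finset.mem_filter]
    refine ⟨Finset.mem_univ _, ?_⟩
    unfold fibre at ht
    rw [Finset.mem_filter] at ht
    rw [← ht.2, prof_apply]
  calc (fibre k).card = ((fibre k).image φ).card := (Finset.card_image_of_injective _ hφ).symm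
    _ ≤ (Fintype.piFinset fun e : Fin 9 => Finset.univ.filter fun b : Bool × Bool × Bool =>
          b.1.toNat + b.2.1.toNat + b.2.2.toNat = (k e : ℕ)).card := Finset.card_le_card himage
    _ = ∏ e : Fin 9, (Finset.univ.filter fun b : Bool × Bool × Bool =>
          b.1.toNat + b.2.1.toNat + b.2.2.toNat = (k e : ℕ)).card := Fintype.card_piFinset _
    _ ≤ ∏ _e : Fin 9, 3 := Finset.prod_le_prod' fun e _ => Deg3.card_bits_le (k e)
    _ = 3 ^ 9 := by simp

/-- **The triple counts are small**: `cnt3 ≤ 3^9 = 19683`. -/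
theorem cnt3_le (T₁ T₂ T₃ : (Fin 9 → Bool) → Bool) (k : Fin 9 → Fin 4) :
    cnt3 T₁ T₂ T₃ k ≤ 19683 :=
  (cnt3_le_card T₁ T₂ T₃ k).trans (card_fibre_le k)

end Kron

end Six

end Deg5

end Summit.Ventures.PercRepro2
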